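import Summits.QuantumFields.BalabanUV.T4Continuum.Support.NE7MinimiserLipschitzStep
import Summits.QuantumFields.BalabanUV.T4Continuum.Support.NE7SliceGaugeLetters
import Summits.QuantumFields.BalabanUV.T4Continuum.Support.NE7MinimalActionDifferentiable
import HarnessLib

/-!
# NE7SliceQuadraticGrowthLift — QUADRATIC GROWTH ON THE GAUGE SLICE UNDER THE STABILISER-LIFTING HYPOTHESIS (G3′) (ROAD-G115 §1): ✓ p825625 `slice_quadratic_growth_of_stab_const` with (G3)
# «stabilisers of `V₀` are CONSTANT gauges fixing `U♯`» weakened to (G3′) «every unitary `N`-periodic stabiliser `s` of `V₀` LIFTS to a unitary `(N·L^{j+1})`-periodic gauge `h` fixing `U♯` with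
# corners `s`» — PROVED at every small datum by ✓ p824904 `NE7StabiliserLifting.stabiliser_lifting` (row NE7b, [NE7bP1-G158-INBOX-2∕3∕4]).  Only change: `u₁ := h⁻¹·u′`, acting on `chart_{U♯}s`
# as the bondwise unitary conjugate `h(x)⁻¹(U♯e^{X′})(b)h(x+e_κ)`; its corner field is `z ↦ s_c(z)⁻¹ū′(z)`.  Lineage `b2b-balaban-t4-ne7-p1` (row NE7 OWNER), gen 115; memo ROAD-G115.md §1.
WHAT ([folklore]; 0 def, 0 sorry; `d = 4`, every `U(n)`, `L ≥ 2`).  **`slice_quadratic_growth_of_lift`**.  HONEST: composition of landed kernel theorems; constants existential; (G3′) a HYPOTHESIS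
here (discharged downstream); nothing of Bałaban's asserted; NOT NE7, NOT NE3; spine 0∕9; finite T⁴ rung (B)+1 — NOT infinite volume, NOT mass gap, NOT BetaPertH, NOT Clay.
-/

set_option autoImplicit false

open scoped BigOperators Matrix Matrix.Norms.L2Operator Topology
open NormedSpace Finset Set Filter Metric

namespace Summit.QuantumFields.BalabanUV.T4Continuum.NE7SliceQuadraticGrowthLift

open Literature.MathematicalPhysics.QuantumFieldTheory.Balaban1983to89 open B7Prop1Explicit B7Prop2Explicit MatrixLog
open T4AveragingDeficitWall (IsUnitaryCfg IsSkewDir SmallField fineAction vary) open T4AveragingDeficitWallBoundary (IsPeriodicCfg periodBox)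
open AveragingDeficitPeriodicCounting (IsPeriodicDir) open AveragingDeficitTorusChart (TDir chart chartDir chart_zero chart_smul redN)
open AveragingDeficitChartCalculus (relLog relLog_self contDiffAt_fineAction_chart) open AveragingDeficitTwoLevelPrep (skewSub skewPR)
open AveragingDeficitMultiLevelPrep (tower levelQ LevelSmall cavgIter cavgIter_unitary_small isPeriodicCfg_cavgIter natCast_tower_succ)
open AveragingDeficitMultiLevelFermat (continuousAt_cavgIter_chart) open AveragingDeficitMultiLevelBridge (cavgIter_eq_avgIter tower_eq)
open AveragingDeficitKDatum (isUnitaryCfg_gaugeAct) open MinimalActionLevels (perWin levelAction stepWt stepWt_pos)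
open MinimalActionSandwich (IsMinimiser admissible) open MinimalActionRate (sfClass)
open NE3EnergyShapes (IsUnitarySite IsPeriodicSite gaugeAct_one) open NE3EnergyWeightedShapes (energyNormW energyNormW_nonneg)
open NE3ResidualSliceRep (isPeriodicCfg_gaugeAct) open T4AveragingDeficitWallBoundary (mem_periodBox)
open NE7MinimiserLipschitzLetters (norm_le_pow_mul_energyNormW_of_mem three_piece norm_mul_inv_sub_one)
open NE7AdmissibleFibreLHC (period_succ_eq) open NE7AdmissibleFibreQuantitativeBase (chart_fibre_quantitative)
open NE7TorusChartDecoding (chart_skewPR_relLog_eq norm_skewPR_relLog_le)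
open NE7MinimalOrbitDatumContinuity (thresholds) open NE7OpenOfMinimisation (tanCritical_of_isMinimiser)
open NE7CriticalOrbitQuadraticGrowthAnyDatum (action_quadratic_growth_any_datum) open NE7EtaMinimiserGaugeCovariance (avgIter_gaugeAct_sfClass isUnitarySite_corner)
open NE7NearStabiliserTorus (near_stabiliser)
open NE7MinimiserLipschitzPrep (gaugeAct_mul_fun isPeriodicSite_corner blockConst_corner blockConst_periodic norm_relVal_eq norm_regauge_sub_le
  norm_gaugeAct_sub_gaugeAct norm_chart_sub_chart_le norm_vary_sub_le)
open AveragingDeficitPlaqDeriv (vary_isUnitaryCfg)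
open NE7SliceGaugeLetters (norm_sub_one_le_of_near_stab gauge_log_box gauge_log_box_eq_zero)

noncomputable section

variable {n : Type} [Fintype n] [DecidableEq n]

set_option maxHeartbeats 2400000 in
/-- **QUADRATIC GROWTH ON THE GAUGE SLICE UNDER (G3′)** (see the module docstring): as `NE7SliceQuadraticGrowth.slice_quadratic_growth`, with the stabiliser hypothesis weakened to
«every unitary `N`-periodic stabiliser of `V₀` lifts to a unitary `(N·L^{j+1})`-periodic gauge fixing `U♯` with those corner values». [folklore] -/
theorem slice_quadratic_growth_of_lift [Nonempty n] {L : ℕ} [NeZero L] (hL : 2 ≤ L) :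
    ∃ ε₀ : ℝ, 0 < ε₀ ∧ ∀ ε : ℝ, 0 < ε → ε ≤ ε₀ → ∀ (N : ℕ) [NeZero N], 1 ≤ N →
      ∀ (V₀ : Site 4 → Fin 4 → (Matrix n n ℂ)ˣ) (j : ℕ) (Us : Site 4 → Fin 4 → (Matrix n n ℂ)ˣ), IsUnitaryCfg V₀ → IsPeriodicCfg V₀ (N : ℤ) →
        IsMinimiser 4 (sfClass 4 L N ε) L N (j + 1) V₀ Us →
        ∀ a : ℝ, 0 ≤ a → a < ε / ((L : ℝ) ^ (j + 1)) ^ 2 → SmallField Us a →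
        (∀ s : Site 4 → (Matrix n n ℂ)ˣ, IsUnitarySite s → IsPeriodicSite s (N : ℤ) → gaugeAct s V₀ = V₀ →
            ∃ h : Site 4 → (Matrix n n ℂ)ˣ, IsUnitarySite h ∧ IsPeriodicSite h ((N * L ^ (j + 1) : ℕ) : ℤ) ∧ gaugeAct h Us = Us ∧
              ∀ z : Site 4, h (((L : ℤ) ^ (j + 1)) • z) = s z) →
        ∀ (σ : ↥(skewSub 4 n (L * tower L N j)) → ↥(skewSub 4 n (L * tower L N j))) (Sl : Submodule ℝ (TDir 4 n (L * tower L N j))),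
          ContDiffAt ℝ 2 σ 0 → σ 0 = 0 →
          (∀ᶠ p : ((Fin 4 → Fin (L * tower L N j)) → Matrix n n ℂ) × ↥(skewSub 4 n (L * tower L N j)) in 𝓝 0,
            (∀ r, p.1 r ∈ skewAdjoint (Matrix n n ℂ)) → (∀ w : Site 4, p.1 (redN (L * tower L N j) (((L : ℤ) ^ (j + 1)) • w)) = 0) →
              (p.2 : TDir 4 n (L * tower L N j)) ∈ Sl →
              σ (skewPR (L * tower L N j) (relLog (L * tower L N j) Us (gaugeAct (fun x : Site 4 => expUnit (p.1 (redN (L * tower L N j) x)))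
                (chart (ContinuousLinearMap.id ℝ (Matrix n n ℂ)) (L * tower L N j) Us (p.2 : TDir 4 n (L * tower L N j)))))) = p.2) →
          ∃ c ρ : ℝ, 0 < c ∧ 0 < ρ ∧ ∀ s : ↥(skewSub 4 n (L * tower L N j)), (s : TDir 4 n (L * tower L N j)) ∈ Sl → ‖s‖ < ρ →
            chart (ContinuousLinearMap.id ℝ (Matrix n n ℂ)) (L * tower L N j) Us (s : TDir 4 n (L * tower L N j)) ∈ admissible (sfClass 4 L N ε) L (j + 1) V₀ →
            c * ‖s‖ ^ 2 ≤ fineAction (chart (ContinuousLinearMap.id ℝ (Matrix n n ℂ)) (L * tower L N j) Us (s : TDir 4 n (L * tower L N j))) (perWin 4 (N * L ^ (j + 1)))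
              - fineAction Us (perWin 4 (N * L ^ (j + 1))) := by
  have hL1 : 1 ≤ L := by omega
  obtain ⟨ε₁, hε₁, H⟩ := thresholds (n := n) hL
  obtain ⟨c₀, hc₀, ε₅, hε₅, H5⟩ := action_quadratic_growth_any_datum (n := n) hL
  refine ⟨min ε₁ ε₅, lt_min hε₁ hε₅, fun ε hε hεle N _ hN V₀ j Us hV₀u hV₀P hUs a ha0 haε hUsa hlift σ Sl hσc hσ0 hleft => ?_⟩
  obtain ⟨-, -, hls, -⟩ := H ε hε (hεle.trans (min_le_left _ _))
  have hquad := H5 ε hε (hεle.trans (min_le_right _ _)) N hN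
  have hcritUs := tanCritical_of_isMinimiser hL1 hN hUs ha0 haε hUsa (hls j)
  have hq := hquad V₀ j Us hUs.mem hcritUs
  have hper : N * L ^ (j + 1) = L * tower L N j := period_succ_eq L N j
  haveI : NeZero (L * tower L N j) := ⟨by rw [← hper]; exact Nat.mul_ne_zero (NeZero.ne N) (pow_ne_zero _ (by omega))⟩
  have hUsU : IsUnitaryCfg Us := hUs.mem.1.1
  have hUsP : IsPeriodicCfg Us ((L * tower L N j : ℕ) : ℤ) := by have h := hUs.mem.1.2.1; rwa [hper] at h
  have eP : ((N * L ^ (j + 1) : ℕ) : ℤ) = (L : ℤ) * (tower L N j : ℕ) := by rw [tower_eq]; push_cast; ring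
  have hUsP' : IsPeriodicCfg Us ((L : ℤ) * (tower L N j : ℕ)) := by rw [← eP]; exact hUs.mem.1.2.1
  have hUsavg : cavgIter L (j + 1) Us = V₀ := by rw [cavgIter_eq_avgIter]; exact hUs.mem.2
  set x₀ : ℝ := ε / ((L : ℝ) ^ (j + 1)) ^ 2 with hx₀
  have hx₀0 : 0 ≤ x₀ := by positivity
  set P : ℝ := (L : ℝ) ^ (j + 1) with hPdef
  have hP1 : 1 ≤ P := one_le_pow₀ (by exact_mod_cast hL1); have hP0 : 0 < P := lt_of_lt_of_le one_pos hP1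
  have hLj : 1 ≤ L ^ (j + 1) := Nat.one_le_pow _ _ (by omega)
  obtain ⟨κ₁, C₁, Cg, ρ₁, hκ₁, hC₁, hCg, hρ₁, hF1⟩ :=
    chart_fibre_quantitative (d := 4) (n := n) hL1 hε.le (hls j) hUs.mem haε hUsa (perWin 4 (N * L ^ (j + 1)))
  obtain ⟨CL', hCL', hnearStab⟩ := near_stabiliser (d := 4) (n := n) hV₀u hV₀P
  obtain ⟨CL₂, hCL₂, hnearStab₂⟩ := near_stabiliser (d := 4) (n := n) hUsU hUsP
  set ch : ↥(skewSub 4 n (L * tower L N j)) → (Site 4 → Fin 4 → (Matrix n n ℂ)ˣ) := fun Φ => chart (ContinuousLinearMap.id ℝ (Matrix n n ℂ)) (L * tower L N j) Us (Φ : TDir 4 n (L * tower L N j)) with hch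
  have hval0 : Tendsto (fun Φ : ↥(skewSub 4 n (L * tower L N j)) => (Φ : TDir 4 n (L * tower L N j))) (𝓝 0) (𝓝 0) := by
    have h := continuous_subtype_val.tendsto (0 : ↥(skewSub 4 n (L * tower L N j))); rwa [Submodule.coe_zero] at h
  have hV3' : ∀ᶠ η : TDir 4 n (L * tower L N j) in 𝓝 0, ∀ (r : Fin 4 → Fin N) (κ' : Fin 4),
      ‖(((V₀ (boxVec N r) κ')⁻¹ : (Matrix n n ℂ)ˣ) : Matrix n n ℂ)
        * (cavgIter L (j + 1) (chart (ContinuousLinearMap.id ℝ (Matrix n n ℂ)) (L * tower L N j) Us η) (boxVec N r) κ' : Matrix n n ℂ) - 1‖ ≤ 1 / 4 := by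
    refine Filter.eventually_all.mpr fun r => Filter.eventually_all.mpr fun κ' => ?_
    have hc0 := continuousAt_cavgIter_chart (d := 4) (n := n) hL1 N j (ContinuousLinearMap.id ℝ (Matrix n n ℂ)) hUsU
      hUsP' hx₀0 (hls j) hUs.mem.1.2.2 (boxVec N r) κ'
    have hcn : ContinuousAt (fun η : TDir 4 n (L * tower L N j) => ‖(((V₀ (boxVec N r) κ')⁻¹ : (Matrix n n ℂ)ˣ) : Matrix n n ℂ)
        * ((cavgIter L (j + 1) (chart (ContinuousLinearMap.id ℝ (Matrix n n ℂ)) (L * tower L N j) Us η) (boxVec N r) κ' : (Matrix n n ℂ)ˣ) : Matrix n n ℂ) - 1‖) 0 :=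
      ((continuousAt_const.mul hc0).sub continuousAt_const).norm
    have h0 : ‖(((V₀ (boxVec N r) κ')⁻¹ : (Matrix n n ℂ)ˣ) : Matrix n n ℂ)
        * ((cavgIter L (j + 1) (chart (ContinuousLinearMap.id ℝ (Matrix n n ℂ)) (L * tower L N j) Us 0) (boxVec N r) κ' : (Matrix n n ℂ)ˣ) : Matrix n n ℂ) - 1‖ < 1 / 4 := by
      rw [chart_zero, hUsavg, Units.inv_mul, sub_self, norm_zero]; norm_num
    exact (hcn.eventually (gt_mem_nhds h0)).mono fun η hη => hη.le
  obtain ⟨ρ₂, hρ₂, hball₂⟩ := Metric.mem_nhds_iff.mp (hval0.eventually hV3')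
  obtain ⟨Kσ, tσ, htσ, hσL⟩ := (hσc.of_le (by norm_num : (1 : WithTop ℕ∞) ≤ 2)).exists_lipschitzOnWith
  obtain ⟨ρσ, hρσ, hballσ⟩ := Metric.mem_nhds_iff.mp htσ
  obtain ⟨ρl, hρl, hleftB⟩ := Metric.eventually_nhds_iff.mp hleft
  have hAc : ContinuousAt (fun Φ : TDir 4 n (L * tower L N j) => fineAction (chart (ContinuousLinearMap.id ℝ (Matrix n n ℂ)) (L * tower L N j) Us Φ) (perWin 4 (N * L ^ (j + 1)))) 0 :=
    (contDiffAt_fineAction_chart (m := 2) (ContinuousLinearMap.id ℝ (Matrix n n ℂ)) (L * tower L N j) Us (perWin 4 (N * L ^ (j + 1))) 0).continuousAt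
  set ρm : ℝ := min ρ₁ (min ρ₂ (min ρσ (min ρl (1 / 2)))) with hρm
  have hρm0 : 0 < ρm := lt_min hρ₁ (lt_min hρ₂ (lt_min hρσ (lt_min hρl (by norm_num))))
  have hρmρ₁ : ρm ≤ ρ₁ := min_le_left _ _; have hρmρ₂ : ρm ≤ ρ₂ := (min_le_right _ _).trans (min_le_left _ _)
  have hρmρσ : ρm ≤ ρσ := (min_le_right _ _).trans ((min_le_right _ _).trans (min_le_left _ _))
  have hρm3 : ρm ≤ min ρl (1 / 2) := (min_le_right _ _).trans ((min_le_right _ _).trans (min_le_right _ _))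
  have hρmρl : ρm ≤ ρl := hρm3.trans (min_le_left _ _); have hρm1 : ρm ≤ 1 / 2 := hρm3.trans (min_le_right _ _)
  set K₁ : ℝ := 16 * CL' * Cg + 2 with hK₁
  have hK₁0 : 0 < K₁ := by rw [hK₁]; positivity
  set Dn : ℝ := (K₁ + 1) * (CL₂ + 1) * (Cg + 1) with hDn
  have hDn1 : 1 ≤ Dn := by
    rw [hDn]; have h1 : (1 : ℝ) ≤ (K₁ + 1) * (CL₂ + 1) := by nlinarith
    nlinarith
  set e₀ : ℝ := ρm / (64 * Dn) with he₀
  have he₀0 : 0 < e₀ := by rw [he₀]; positivity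
  have he₀a : 64 * Dn * e₀ = ρm := by rw [he₀]; field_simp
  have hbud : ∀ t : ℝ, 0 ≤ t → t ≤ Dn → 64 * t * e₀ ≤ ρm := fun t ht0 ht => by
    rw [← he₀a]; exact mul_le_mul_of_nonneg_right (by linarith) he₀0.le
  have he₀1 : e₀ ≤ 1 / 16 := by have h := hbud 1 zero_le_one hDn1; linarith
  have hK₁D : K₁ ≤ Dn := by rw [hDn]; nlinarith [show (1 : ℝ) ≤ (CL₂ + 1) * (Cg + 1) by nlinarith]
  have hCKD : CL₂ * K₁ ≤ Dn := by rw [hDn]; nlinarith [show CL₂ * K₁ ≤ (K₁ + 1) * (CL₂ + 1) by nlinarith]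
  have hCgD : Cg ≤ Dn := by rw [hDn]; nlinarith [show (1 : ℝ) ≤ (K₁ + 1) * (CL₂ + 1) by nlinarith]
  set τA : ℝ := c₀ * (e₀ / P) ^ 2 with hτA
  have hτA0 : 0 < τA := by positivity
  have hAev : ∀ᶠ Φ : TDir 4 n (L * tower L N j) in 𝓝 0, dist (fineAction (chart (ContinuousLinearMap.id ℝ (Matrix n n ℂ)) (L * tower L N j) Us Φ) (perWin 4 (N * L ^ (j + 1))))
      (fineAction (chart (ContinuousLinearMap.id ℝ (Matrix n n ℂ)) (L * tower L N j) Us 0) (perWin 4 (N * L ^ (j + 1)))) < τA := Metric.tendsto_nhds.mp hAc τA hτA0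
  obtain ⟨ρA, hρA, hballA⟩ := Metric.eventually_nhds_iff.mp (hval0.eventually hAev)
  set ρ : ℝ := min (ρm / (32 * (CL₂ + 1))) ρA with hρdef
  have hρ0 : 0 < ρ := lt_min (by positivity) hρA
  set Kf : ℝ := 2 * (Kσ : ℝ) * K₁ * P with hKf
  refine ⟨c₀ / (Kf ^ 2 + 1), ρ, by positivity, hρ0, fun sₛ hsSl hsρ hadm => ?_⟩
  have hsρm : ‖sₛ‖ < ρm / (32 * (CL₂ + 1)) := hsρ.trans_le (min_le_left _ _)
  have hsρm' : 32 * (CL₂ + 1) * ‖sₛ‖ < ρm := by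
    have h := (lt_div_iff₀ (by positivity : (0:ℝ) < 32 * (CL₂ + 1))).mp hsρm; linarith
  have hslt : ‖sₛ‖ < ρm := by nlinarith [norm_nonneg sₛ]
  have hs1 : ‖sₛ‖ ≤ ρm := hslt.le
  obtain ⟨u', X', hu', hu'P, hX's, hX'P, hgauge', hE⟩ := hq _ hadm
  set E : ℝ := energyNormW L (j + 1) Us X' (periodBox (d := 4) (N * L ^ (j + 1))) with hEdef
  have hE0 : 0 ≤ E := energyNormW_nonneg _ _ _ _ _
  have hΔ : fineAction (ch sₛ) (perWin 4 (N * L ^ (j + 1))) - fineAction Us (perWin 4 (N * L ^ (j + 1))) < τA := by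
    have h := hballA (show dist sₛ 0 < ρA from by rw [dist_zero_right]; exact hsρ.trans_le (min_le_right _ _))
    rw [chart_zero, Real.dist_eq] at h
    exact (le_abs_self _).trans_lt h
  have hPE : P * E ≤ e₀ := by
    have h1 : c₀ * E ^ 2 < c₀ * (e₀ / P) ^ 2 := hE.trans_lt hΔ
    have h2 : E ^ 2 < (e₀ / P) ^ 2 := lt_of_mul_lt_mul_left h1 hc₀.le
    have h3 : E < e₀ / P := by
      have := (pow_lt_pow_iff_left₀ hE0 (by positivity : (0:ℝ) ≤ e₀ / P) two_ne_zero).mp h2; exact this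
    have h4 := (lt_div_iff₀ hP0).mp h3
    linarith
  have hX'n : ∀ (r : Fin 4 → Fin (L * tower L N j)) (κ' : Fin 4), ‖X' (boxVec (L * tower L N j) r) κ'‖ ≤ P * E := fun r κ' => by
    have hx : boxVec (L * tower L N j) r ∈ periodBox (d := 4) (N * L ^ (j + 1)) := by
      rw [hper]; exact mem_periodBox.2 fun i => ⟨by simp [boxVec], by simp only [boxVec]; exact_mod_cast (r i).is_lt⟩
    exact norm_le_pow_mul_energyNormW_of_mem hL1 (j + 1) Us X' hx κ'
  set Y : Site 4 → Fin 4 → (Matrix n n ℂ)ˣ := vary Us X' 1 with hYdef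
  have hYnear : ∀ (r : Fin 4 → Fin (L * tower L N j)) (κ' : Fin 4),
      ‖(((Us (boxVec (L * tower L N j) r) κ')⁻¹ : (Matrix n n ℂ)ˣ) : Matrix n n ℂ) * ((Y (boxVec (L * tower L N j) r) κ' : (Matrix n n ℂ)ˣ) : Matrix n n ℂ) - 1‖ ≤ 2 * (P * E) := fun r κ' =>
    (norm_vary_sub_le (W := Us) (boxVec (L * tower L N j) r) κ' ((hX'n r κ').trans (hPE.trans (by linarith)))).trans (by linarith [hX'n r κ'])
  have hYu : IsUnitaryCfg Y := vary_isUnitaryCfg hUsU hX's 1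
  have hYeq : Y = gaugeAct u' (ch sₛ) := hgauge'.symm
  have hYP : IsPeriodicCfg Y ((L * tower L N j : ℕ) : ℤ) := by rw [hYeq, ← hper]; exact isPeriodicCfg_gaugeAct hu'P hadm.1.2.1
  set Φ'' : ↥(skewSub 4 n (L * tower L N j)) := skewPR (L * tower L N j) (relLog (L * tower L N j) Us Y) with hΦ''
  have hdecY : ch Φ'' = Y := chart_skewPR_relLog_eq hUsU hYu hUsP hYP fun r κ' => (hYnear r κ').trans (by linarith)
  have hΦ''n : ‖Φ''‖ ≤ 4 * (P * E) := (norm_skewPR_relLog_le (by positivity) (by linarith) hYnear).trans (by linarith)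
  have hΦ''ρ : ‖Φ''‖ < ρm := by
    have h2 := hbud 1 zero_le_one hDn1
    linarith
  set ub' : Site 4 → (Matrix n n ℂ)ˣ := fun z : Site 4 => u' (((L : ℤ) ^ (j + 1)) • z) with hub'
  have hub'u : IsUnitarySite ub' := fun z => isUnitarySite_corner hu' _ z
  have hub'P : IsPeriodicSite ub' (N : ℤ) := by
    have h : IsPeriodicSite (fun z : Site 4 => u' (((L ^ (j + 1) : ℕ) : ℤ) • z)) (N : ℤ) := isPeriodicSite_corner hu'P
    simpa only [Nat.cast_pow] using h
  have hYavg : cavgIter L (j + 1) Y = gaugeAct ub' V₀ := by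
    rw [cavgIter_eq_avgIter, hYeq, avgIter_gaugeAct_sfClass hL1 hε.le j (hls j) hadm.1 hu', ← cavgIter_eq_avgIter]
    show gaugeAct ub' (cavgIter L (j + 1) (ch sₛ)) = gaugeAct ub' V₀
    rw [cavgIter_eq_avgIter, hadm.2]
  set y' : ↥(skewSub 4 n N) := levelQ L N j Us (ch Φ'') with hy'
  have hy'eq : y' = skewPR N (relLog N V₀ (gaugeAct ub' V₀)) := by
    show skewPR N (relLog N (cavgIter L (j + 1) Us) (cavgIter L (j + 1) (ch Φ''))) = _
    rw [hdecY, hUsavg, hYavg]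
  have hy'n : ‖y'‖ ≤ Cg * (4 * (P * E)) := ((hF1 Φ'' (hΦ''ρ.trans_le hρmρ₁).le).1).trans (mul_le_mul_of_nonneg_left hΦ''n hCg)
  have hy'1 : ‖y'‖ ≤ 1 := by
    have h1 : Cg * (4 * (P * E)) ≤ Cg * (4 * e₀) := mul_le_mul_of_nonneg_left (by linarith) hCg
    have h2 := hbud Cg hCg hCgD
    linarith
  have hD'near := hball₂ (mem_ball_zero_iff.mpr (hΦ''ρ.trans_le hρmρ₂))
  simp only [mem_setOf_eq] at hD'near
  have hdecY' : chart (ContinuousLinearMap.id ℝ (Matrix n n ℂ)) (L * tower L N j) Us ((Φ'' : ↥(skewSub 4 n (L * tower L N j))) : TDir 4 n (L * tower L N j)) = Y := hdecY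
  rw [hdecY', hYavg] at hD'near
  have hD'u : IsUnitaryCfg (gaugeAct ub' V₀) := isUnitaryCfg_gaugeAct hub'u hV₀u
  have hD'P : IsPeriodicCfg (gaugeAct ub' V₀) (N : ℤ) := isPeriodicCfg_gaugeAct hub'P hV₀P
  have hdecD : chart (ContinuousLinearMap.id ℝ (Matrix n n ℂ)) N V₀ ((y' : ↥(skewSub 4 n N)) : TDir 4 n N) = gaugeAct ub' V₀ := by
    rw [hy'eq]; exact chart_skewPR_relLog_eq hV₀u hD'u hV₀P hD'P hD'near
  have hdefect : ∀ (r : Fin 4 → Fin N) (κ' : Fin 4),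
      ‖(((V₀ (boxVec N r) κ')⁻¹ : (Matrix n n ℂ)ˣ) : Matrix n n ℂ) * ((gaugeAct ub' V₀ (boxVec N r) κ' : (Matrix n n ℂ)ˣ) : Matrix n n ℂ) - 1‖ ≤ 8 * Cg * (P * E) := by
    intro r κ'
    have hcv : gaugeAct ub' V₀ = vary V₀ (chartDir (ContinuousLinearMap.id ℝ (Matrix n n ℂ)) N ((y' : ↥(skewSub 4 n N)) : TDir 4 n N)) 1 := by
      rw [← hdecD, ← chart_smul, one_smul]
    have hcomp : ‖chartDir (ContinuousLinearMap.id ℝ (Matrix n n ℂ)) N ((y' : ↥(skewSub 4 n N)) : TDir 4 n N) (boxVec N r) κ'‖ ≤ ‖y'‖ := by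
      simp only [chartDir, ContinuousLinearMap.id_apply]
      rw [Submodule.coe_norm]
      exact (norm_le_pi_norm (((y' : ↥(skewSub 4 n N)) : TDir 4 n N) (redN N (boxVec N r))) κ').trans (norm_le_pi_norm _ _)
    rw [hcv]
    exact (norm_vary_sub_le (W := V₀) (boxVec N r) κ' (hcomp.trans hy'1)).trans (by linarith)
  obtain ⟨sc, hscu, hscP, hscfix, hscn⟩ := hnearStab ub' hub'u hub'P (8 * Cg * (P * E)) (by positivity) hdefect
  obtain ⟨h, hhu, hhP, hhfix, hhc⟩ := hlift sc hscu hscP hscfix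
  have hfixb : ∀ (x : Site 4) (κ : Fin 4), (h x)⁻¹ * Us x κ * h (x + e κ) = Us x κ := fun x κ => by
    have h1 := congr_fun (congr_fun hhfix x) κ
    simp only [gaugeAct] at h1
    calc (h x)⁻¹ * Us x κ * h (x + e κ) = (h x)⁻¹ * (h x * Us x κ * (h (x + e κ))⁻¹) * h (x + e κ) := by rw [h1]
      _ = Us x κ := by group
  set u₁ : Site 4 → (Matrix n n ℂ)ˣ := fun x => (h x)⁻¹ * u' x with hu₁
  have hu₁u : IsUnitarySite u₁ := fun x => (unitaryUnits _).mul_mem ((unitaryUnits _).inv_mem (hhu x)) (hu' x)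
  have hu'PM : IsPeriodicSite u' ((L * tower L N j : ℕ) : ℤ) := (by have h1 := hu'P; rwa [hper] at h1); have hhPM : IsPeriodicSite h ((L * tower L N j : ℕ) : ℤ) := (by have h1 := hhP; rwa [hper] at h1)
  have hu₁P : IsPeriodicSite u₁ ((L * tower L N j : ℕ) : ℤ) := fun x i => by simp only [hu₁, hu'PM x i, hhPM x i]
  -- the conjugate copy `Y₁ = h⁻¹·Y = u₁·(chart s)`: bondwise as close to `U♯ = h⁻¹·U♯` as `Y`
  set Y₁ : Site 4 → Fin 4 → (Matrix n n ℂ)ˣ := gaugeAct u₁ (ch sₛ) with hY₁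
  have hY₁conj : ∀ (x : Site 4) (κ : Fin 4), Y₁ x κ = (h x)⁻¹ * Y x κ * h (x + e κ) := fun x κ => by
    rw [hY₁, hYeq]; simp only [gaugeAct, hu₁, mul_inv_rev, inv_inv]; group
  have hY₁u : IsUnitaryCfg Y₁ := isUnitaryCfg_gaugeAct hu₁u hadm.1.1
  have hY₁P : IsPeriodicCfg Y₁ ((L * tower L N j : ℕ) : ℤ) := isPeriodicCfg_gaugeAct hu₁P (by have h := hadm.1.2.1; rwa [hper] at h)
  have hY₁near : ∀ (r : Fin 4 → Fin (L * tower L N j)) (κ' : Fin 4),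
      ‖(((Us (boxVec (L * tower L N j) r) κ')⁻¹ : (Matrix n n ℂ)ˣ) : Matrix n n ℂ) * ((Y₁ (boxVec (L * tower L N j) r) κ' : (Matrix n n ℂ)ˣ) : Matrix n n ℂ) - 1‖ ≤ 2 * (P * E) := by
    intro r κ'
    letI : CStarAlgebra (Matrix n n ℂ) := {}
    have e1 : (Us (boxVec (L * tower L N j) r) κ')⁻¹ * Y₁ (boxVec (L * tower L N j) r) κ'
        = (h (boxVec (L * tower L N j) r + e κ'))⁻¹ * ((Us (boxVec (L * tower L N j) r) κ')⁻¹ * Y (boxVec (L * tower L N j) r) κ') * h (boxVec (L * tower L N j) r + e κ') := by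
      rw [hY₁conj]
      conv_lhs => rw [← hfixb (boxVec (L * tower L N j) r) κ']
      group
    have e2 : (((Us (boxVec (L * tower L N j) r) κ')⁻¹ : (Matrix n n ℂ)ˣ) : Matrix n n ℂ) * ((Y₁ (boxVec (L * tower L N j) r) κ' : (Matrix n n ℂ)ˣ) : Matrix n n ℂ) - 1
        = (((h (boxVec (L * tower L N j) r + e κ'))⁻¹ : (Matrix n n ℂ)ˣ) : Matrix n n ℂ) * ((((Us (boxVec (L * tower L N j) r) κ')⁻¹ : (Matrix n n ℂ)ˣ) : Matrix n n ℂ)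
            * ((Y (boxVec (L * tower L N j) r) κ' : (Matrix n n ℂ)ˣ) : Matrix n n ℂ) - 1) * (h (boxVec (L * tower L N j) r + e κ') : Matrix n n ℂ) := by
      have h1 := congrArg Units.val e1
      simp only [Units.val_mul] at h1
      rw [h1, mul_sub, sub_mul, mul_one, Units.inv_mul]
    rw [e2, CStarRing.norm_mul_mem_unitary _ (mem_unitaryUnits.mp (hhu _)), CStarRing.norm_mem_unitary_mul _ (NE7DatumCoordinateStabiliser.inv_mem_unitary (hhu _))]
    exact hYnear r κ'
  -- the corner field of `u₁` is `z ↦ s_c(z)⁻¹·ū′(z)` (by the corner clause of the lift), `N`-periodic, within `C_L·(8C_g·PE)` of `1`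
  set g'' : Site 4 → (Matrix n n ℂ)ˣ := fun z => (sc z)⁻¹ * ub' z with hg''
  have hg''P : ∀ (z : Site 4) (i : Fin 4), g'' (z + (N : ℤ) • e i) = g'' z := fun z i => by simp only [hg'', hub'P z i, hscP z i]
  have hg''u : ∀ z, g'' z ∈ unitaryUnits (Matrix n n ℂ) := fun z => (unitaryUnits _).mul_mem ((unitaryUnits _).inv_mem (hscu z)) (hub'u z)
  have hg''1 : ∀ z : Site 4, ‖(g'' z : Matrix n n ℂ) - 1‖ ≤ CL' * (8 * Cg * (P * E)) := fun z => by
    letI : CStarAlgebra (Matrix n n ℂ) := {}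
    have e1 : (((sc z)⁻¹ * ub' z : (Matrix n n ℂ)ˣ) : Matrix n n ℂ) - 1 = (((sc z)⁻¹ : (Matrix n n ℂ)ˣ) : Matrix n n ℂ) * ((ub' z : Matrix n n ℂ) - (sc z : Matrix n n ℂ)) := by
      rw [Units.val_mul, mul_sub, Units.inv_mul]
    have e0 : g'' z = (sc z)⁻¹ * ub' z := rfl
    rw [e0, e1, CStarRing.norm_mem_unitary_mul _ (NE7DatumCoordinateStabiliser.inv_mem_unitary (hscu z))]
    exact hscn z
  set hB : Site 4 → (Matrix n n ℂ)ˣ := fun x => g'' (fun i => x i / ((L ^ (j + 1) : ℕ) : ℤ)) with hhB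
  have hhBu : IsUnitarySite hB := fun x => hg''u _
  have hhBP : IsPeriodicSite hB ((N * L ^ (j + 1) : ℕ) : ℤ) := fun x i => blockConst_periodic hLj hg''P x i
  have hhBP' : IsPeriodicSite hB ((L * tower L N j : ℕ) : ℤ) := by have h := hhBP; rwa [hper] at h
  have hhBc : ∀ z : Site 4, hB (((L : ℤ) ^ (j + 1)) • z) = g'' z := fun z => by
    have h := blockConst_corner g'' hLj z; simp only [Nat.cast_pow] at h; exact h
  have hhB1 : ∀ x : Site 4, ‖(hB x : Matrix n n ℂ) - 1‖ ≤ CL' * (8 * Cg * (P * E)) := fun x => hg''1 _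
  set g' : Site 4 → (Matrix n n ℂ)ˣ := fun x => (hB x)⁻¹ * u₁ x with hg'
  have hg'u : IsUnitarySite g' := fun x => (unitaryUnits _).mul_mem ((unitaryUnits _).inv_mem (hhBu x)) (hu₁u x)
  have hg'P : IsPeriodicSite g' ((L * tower L N j : ℕ) : ℤ) := fun x i => by simp only [hg', hhBP' x i, hu₁P x i]
  have hg'c : ∀ w : Site 4, g' (((L : ℤ) ^ (j + 1)) • w) = 1 := fun w => by simp only [hg', hhBc, hg'', hu₁, hub', hhc w]; group
  have hg'0 : g' 0 = 1 := by have h := hg'c 0; rwa [smul_zero] at h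
  have hsplit : gaugeAct u₁ (ch sₛ) = gaugeAct hB (gaugeAct g' (ch sₛ)) := by
    rw [← gaugeAct_mul_fun]; congr 1; funext x; simp only [hg', mul_inv_cancel_left]
  set Yh : Site 4 → Fin 4 → (Matrix n n ℂ)ˣ := gaugeAct (fun x => (hB x)⁻¹) Y₁ with hYh
  have hYh_eq : gaugeAct g' (ch sₛ) = Yh := by
    have h1 : gaugeAct hB (gaugeAct g' (ch sₛ)) = Y₁ := by rw [hY₁]; exact hsplit.symm
    rw [hYh, ← h1, ← gaugeAct_mul_fun]
    have h2 : (fun x => (hB x)⁻¹ * hB x) = fun _ : Site 4 => (1 : (Matrix n n ℂ)ˣ) := by funext x; rw [inv_mul_cancel]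
    rw [h2, gaugeAct_one]
  have hYhu : IsUnitaryCfg Yh := by rw [← hYh_eq]; exact isUnitaryCfg_gaugeAct hg'u hadm.1.1
  have hYhP : IsPeriodicCfg Yh ((L * tower L N j : ℕ) : ℤ) := by rw [← hYh_eq]; exact isPeriodicCfg_gaugeAct hg'P (by have h := hadm.1.2.1; rwa [hper] at h)
  have hinv1 : ∀ {w : (Matrix n n ℂ)ˣ}, w ∈ unitaryUnits (Matrix n n ℂ) → ‖((w⁻¹ : (Matrix n n ℂ)ˣ) : Matrix n n ℂ) - 1‖ = ‖(w : Matrix n n ℂ) - 1‖ := fun hw => by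
    have h := norm_mul_inv_sub_one 1 hw; rw [Units.val_one, one_mul] at h; rw [h, norm_sub_rev]
  set ηh : ℝ := 2 * (CL' * (8 * Cg * (P * E))) + 2 * (P * E) with hηh
  have hηhK : ηh = K₁ * (P * E) := by rw [hηh, hK₁]; ring
  have hK₁e : K₁ * (P * E) ≤ ρm / 64 := by
    have h1 : K₁ * (P * E) ≤ K₁ * e₀ := mul_le_mul_of_nonneg_left hPE hK₁0.le
    have h2 := hbud K₁ hK₁0.le hK₁D
    linarith
  have hYhnear : ∀ (r : Fin 4 → Fin (L * tower L N j)) (κ' : Fin 4),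
      ‖(((Us (boxVec (L * tower L N j) r) κ')⁻¹ : (Matrix n n ℂ)ˣ) : Matrix n n ℂ) * ((Yh (boxVec (L * tower L N j) r) κ' : (Matrix n n ℂ)ˣ) : Matrix n n ℂ) - 1‖ ≤ ηh := by
    intro r κ'
    have hUsb := hUsU (boxVec (L * tower L N j) r) κ'
    rw [norm_relVal_eq hUsb]
    have h1 : ‖(Yh (boxVec (L * tower L N j) r) κ' : Matrix n n ℂ) - (Y₁ (boxVec (L * tower L N j) r) κ' : Matrix n n ℂ)‖ ≤ 2 * (CL' * (8 * Cg * (P * E))) := by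
      have e1 : (Yh (boxVec (L * tower L N j) r) κ' : Matrix n n ℂ) = (((hB (boxVec (L * tower L N j) r))⁻¹ : (Matrix n n ℂ)ˣ) : Matrix n n ℂ) * (Y₁ (boxVec (L * tower L N j) r) κ' : Matrix n n ℂ)
          * ((((hB (boxVec (L * tower L N j) r + e κ'))⁻¹)⁻¹ : (Matrix n n ℂ)ˣ) : Matrix n n ℂ) := by
        simp only [hYh, gaugeAct, Units.val_mul]
      rw [e1]
      refine (norm_regauge_sub_le ((unitaryUnits _).inv_mem (hhBu _)) (hY₁u _ _)).trans ?_
      rw [hinv1 (hhBu _), hinv1 (hhBu _)]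
      linarith [hhB1 (boxVec (L * tower L N j) r), hhB1 (boxVec (L * tower L N j) r + e κ')]
    have h2 : ‖(Y₁ (boxVec (L * tower L N j) r) κ' : Matrix n n ℂ) - (Us (boxVec (L * tower L N j) r) κ' : Matrix n n ℂ)‖ ≤ 2 * (P * E) := by
      rw [← norm_relVal_eq hUsb]; exact hY₁near r κ'
    calc ‖(Yh (boxVec (L * tower L N j) r) κ' : Matrix n n ℂ) - (Us (boxVec (L * tower L N j) r) κ' : Matrix n n ℂ)‖
        = ‖((Yh (boxVec (L * tower L N j) r) κ' : Matrix n n ℂ) - (Y₁ (boxVec (L * tower L N j) r) κ' : Matrix n n ℂ))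
            + ((Y₁ (boxVec (L * tower L N j) r) κ' : Matrix n n ℂ) - (Us (boxVec (L * tower L N j) r) κ' : Matrix n n ℂ))‖ := by rw [sub_add_sub_cancel]
      _ ≤ ‖(Yh (boxVec (L * tower L N j) r) κ' : Matrix n n ℂ) - (Y₁ (boxVec (L * tower L N j) r) κ' : Matrix n n ℂ)‖
            + ‖(Y₁ (boxVec (L * tower L N j) r) κ' : Matrix n n ℂ) - (Us (boxVec (L * tower L N j) r) κ' : Matrix n n ℂ)‖ := norm_add_le _ _
      _ ≤ ηh := by rw [hηh]; linarith
  have hηh0 : 0 ≤ ηh := by rw [hηhK]; positivity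
  have hηh8 : ηh ≤ 1 / 8 := by rw [hηhK]; linarith
  set Φh : ↥(skewSub 4 n (L * tower L N j)) := skewPR (L * tower L N j) (relLog (L * tower L N j) Us Yh) with hΦh
  have hdecYh : ch Φh = Yh := chart_skewPR_relLog_eq hUsU hYhu hUsP hYhP fun r κ' => (hYhnear r κ').trans (by linarith)
  have hΦhn : ‖Φh‖ ≤ 2 * ηh := norm_skewPR_relLog_le hηh0 (by linarith) hYhnear
  have hΦhK : ‖Φh‖ ≤ 2 * (K₁ * (P * E)) := by rw [← hηhK]; exact hΦhn
  have hΦhρ : ‖Φh‖ < ρm := by linarith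
  have hsTD1 : ‖((sₛ : ↥(skewSub 4 n (L * tower L N j))) : TDir 4 n (L * tower L N j))‖ ≤ 1 := by rw [← Submodule.coe_norm]; linarith
  have hΦh1 : ‖((Φh : ↥(skewSub 4 n (L * tower L N j))) : TDir 4 n (L * tower L N j))‖ ≤ 1 := by rw [← Submodule.coe_norm]; linarith
  set ηf : ℝ := 3 * ‖sₛ‖ + 3 * ‖Φh‖ with hηf
  have hηf0 : 0 ≤ ηf := by positivity
  have hg'near : ∀ (r : Fin 4 → Fin (L * tower L N j)) (κ' : Fin 4),
      ‖(((Us (boxVec (L * tower L N j) r) κ')⁻¹ : (Matrix n n ℂ)ˣ) : Matrix n n ℂ) * ((gaugeAct g' Us (boxVec (L * tower L N j) r) κ' : (Matrix n n ℂ)ˣ) : Matrix n n ℂ) - 1‖ ≤ ηf := by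
    intro r κ'
    have hUsb := hUsU (boxVec (L * tower L N j) r) κ'
    rw [norm_relVal_eq hUsb]
    have h1 : ‖((gaugeAct g' Us (boxVec (L * tower L N j) r) κ' : (Matrix n n ℂ)ˣ) : Matrix n n ℂ) - ((gaugeAct g' (ch sₛ) (boxVec (L * tower L N j) r) κ' : (Matrix n n ℂ)ˣ) : Matrix n n ℂ)‖ ≤ 3 * ‖sₛ‖ := by
      rw [norm_gaugeAct_sub_gaugeAct hg'u]
      have h := norm_chart_sub_chart_le hUsU (Φ := (0 : TDir 4 n (L * tower L N j))) (Φ' := ((sₛ : ↥(skewSub 4 n (L * tower L N j))) : TDir 4 n (L * tower L N j)))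
        (by rw [norm_zero]; norm_num) hsTD1 (boxVec (L * tower L N j) r) κ'
      rw [chart_zero, zero_sub, norm_neg, ← Submodule.coe_norm] at h
      exact h
    have h2 : ‖((gaugeAct g' (ch sₛ) (boxVec (L * tower L N j) r) κ' : (Matrix n n ℂ)ˣ) : Matrix n n ℂ) - (Us (boxVec (L * tower L N j) r) κ' : Matrix n n ℂ)‖ ≤ 3 * ‖Φh‖ := by
      rw [hYh_eq, ← hdecYh]
      have h := norm_chart_sub_chart_le hUsU (Φ := ((Φh : ↥(skewSub 4 n (L * tower L N j))) : TDir 4 n (L * tower L N j))) (Φ' := (0 : TDir 4 n (L * tower L N j)))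
        hΦh1 (by rw [norm_zero]; norm_num) (boxVec (L * tower L N j) r) κ'
      rw [chart_zero, sub_zero, ← Submodule.coe_norm] at h
      exact h
    calc ‖((gaugeAct g' Us (boxVec (L * tower L N j) r) κ' : (Matrix n n ℂ)ˣ) : Matrix n n ℂ) - (Us (boxVec (L * tower L N j) r) κ' : Matrix n n ℂ)‖
        = ‖(((gaugeAct g' Us (boxVec (L * tower L N j) r) κ' : (Matrix n n ℂ)ˣ) : Matrix n n ℂ) - ((gaugeAct g' (ch sₛ) (boxVec (L * tower L N j) r) κ' : (Matrix n n ℂ)ˣ) : Matrix n n ℂ))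
            + (((gaugeAct g' (ch sₛ) (boxVec (L * tower L N j) r) κ' : (Matrix n n ℂ)ˣ) : Matrix n n ℂ) - (Us (boxVec (L * tower L N j) r) κ' : Matrix n n ℂ))‖ := by rw [sub_add_sub_cancel]
      _ ≤ ‖((gaugeAct g' Us (boxVec (L * tower L N j) r) κ' : (Matrix n n ℂ)ˣ) : Matrix n n ℂ) - ((gaugeAct g' (ch sₛ) (boxVec (L * tower L N j) r) κ' : (Matrix n n ℂ)ˣ) : Matrix n n ℂ)‖
            + ‖((gaugeAct g' (ch sₛ) (boxVec (L * tower L N j) r) κ' : (Matrix n n ℂ)ˣ) : Matrix n n ℂ) - (Us (boxVec (L * tower L N j) r) κ' : Matrix n n ℂ)‖ := norm_add_le _ _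
      _ ≤ ηf := by rw [hηf]; linarith
  obtain ⟨s₁, -, hs₁P, hs₁fix, hs₁n⟩ := hnearStab₂ g' hg'u hg'P ηf hηf0 hg'near
  have hg'1 : ∀ x : Site 4, ‖(g' x : Matrix n n ℂ) - 1‖ ≤ 2 * (CL₂ * ηf) := fun x => norm_sub_one_le_of_near_stab hUsU hs₁P hs₁fix hg'0 hs₁n x
  have hCL₂s : CL₂ * ‖sₛ‖ ≤ ρm / 32 := by
    have h1 : CL₂ * ‖sₛ‖ ≤ (CL₂ + 1) * ‖sₛ‖ := by nlinarith [norm_nonneg sₛ]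
    linarith
  have hCL₂K : CL₂ * K₁ * (P * E) ≤ ρm / 64 := by
    have h1 : CL₂ * K₁ * (P * E) ≤ CL₂ * K₁ * e₀ := mul_le_mul_of_nonneg_left hPE (by positivity)
    have h2 := hbud (CL₂ * K₁) (by positivity) hCKD
    linarith
  have hδg : CL₂ * ηf ≤ 3 * ρm / 16 := by
    have h1 : CL₂ * ηf = 3 * (CL₂ * ‖sₛ‖) + 3 * (CL₂ * ‖Φh‖) := by rw [hηf]; ring
    have h2 : CL₂ * ‖Φh‖ ≤ CL₂ * (2 * (K₁ * (P * E))) := mul_le_mul_of_nonneg_left hΦhK hCL₂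
    have h3 : CL₂ * (2 * (K₁ * (P * E))) = 2 * (CL₂ * K₁ * (P * E)) := by ring
    rw [h1]; linarith
  have h2δ : 2 * (CL₂ * ηf) ≤ 1 / 4 := by linarith
  obtain ⟨hζskew, hζn, hζexp⟩ := gauge_log_box (M := L * tower L N j) hg'u hg'P h2δ hg'1
  set ζ : (Fin 4 → Fin (L * tower L N j)) → Matrix n n ℂ := fun r => mlog (g' (boxVec (L * tower L N j) r) : Matrix n n ℂ) with hζdef
  have hζc : ∀ w : Site 4, ζ (redN (L * tower L N j) (((L : ℤ) ^ (j + 1)) • w)) = 0 := fun w => gauge_log_box_eq_zero hg'P (hg'c w)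
  have hζnorm : ‖ζ‖ ≤ 2 * (2 * (CL₂ * ηf)) := (pi_norm_le_iff_of_nonneg (by positivity)).mpr fun r => hζn r
  have hdist : dist ((ζ, sₛ) : ((Fin 4 → Fin (L * tower L N j)) → Matrix n n ℂ) × ↥(skewSub 4 n (L * tower L N j))) 0 < ρl := by
    rw [dist_zero_right, Prod.norm_mk]; exact max_lt (by linarith) (by linarith)
  have hσΦ : σ Φh = sₛ := by
    have h := hleftB hdist hζskew hζc hsSl
    have hA' : Φh = skewPR (L * tower L N j) (relLog (L * tower L N j) Us (gaugeAct (fun x : Site 4 => expUnit (ζ (redN (L * tower L N j) x)))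
        (chart (ContinuousLinearMap.id ℝ (Matrix n n ℂ)) (L * tower L N j) Us ((sₛ : ↥(skewSub 4 n (L * tower L N j))) : TDir 4 n (L * tower L N j))))) := by
      rw [hζexp]
      show Φh = skewPR (L * tower L N j) (relLog (L * tower L N j) Us (gaugeAct g' (ch sₛ)))
      rw [hYh_eq]
    rw [hA']
    exact h
  have hΦhσ : Φh ∈ tσ := hballσ (mem_ball_zero_iff.mpr (hΦhρ.trans_le hρmρσ))
  have h0σ : (0 : ↥(skewSub 4 n (L * tower L N j))) ∈ tσ := hballσ (mem_ball_self hρσ)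
  have hsn : ‖sₛ‖ ≤ Kσ * ‖Φh‖ := by
    have h := hσL.norm_sub_le hΦhσ h0σ
    rw [hσ0, sub_zero, sub_zero, hσΦ] at h
    exact h
  have hsn2 : ‖sₛ‖ ≤ Kf * E := by
    have h1 : (Kσ : ℝ) * ‖Φh‖ ≤ Kσ * (2 * (K₁ * (P * E))) := mul_le_mul_of_nonneg_left hΦhK (NNReal.coe_nonneg Kσ)
    have h2 : (Kσ : ℝ) * (2 * (K₁ * (P * E))) = Kf * E := by rw [hKf]; ring
    linarith
  have hc : c₀ / (Kf ^ 2 + 1) * ‖sₛ‖ ^ 2 ≤ c₀ * E ^ 2 := by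
    have h1 : ‖sₛ‖ ^ 2 ≤ (Kf * E) ^ 2 := pow_le_pow_left₀ (norm_nonneg _) hsn2 2
    have h2 : c₀ / (Kf ^ 2 + 1) * ‖sₛ‖ ^ 2 ≤ c₀ / (Kf ^ 2 + 1) * (Kf * E) ^ 2 := mul_le_mul_of_nonneg_left h1 (by positivity)
    have h3 : c₀ / (Kf ^ 2 + 1) * (Kf * E) ^ 2 = c₀ * E ^ 2 * (Kf ^ 2 / (Kf ^ 2 + 1)) := by ring
    have h4 : Kf ^ 2 / (Kf ^ 2 + 1) ≤ 1 := (div_le_one (by positivity)).mpr (by linarith)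
    have h5 : c₀ * E ^ 2 * (Kf ^ 2 / (Kf ^ 2 + 1)) ≤ c₀ * E ^ 2 := mul_le_of_le_one_right (by positivity) h4
    linarith
  exact hc.trans hE

end

end Summit.QuantumFields.BalabanUV.T4Continuum.NE7SliceQuadraticGrowthLift
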